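import Mathlib
import Literature.Computability.AlgebraicComplexity.NestFreeMatchingPoly
import Summits.ValiantsHypothesis.ValiantsHypothesis.Theorems.FifoMatchingNNDivisionHardStackPowersQueue
import HarnessLib

/-!
# Route FifoMatching — crux `NNDivisionHard` (stmt-ValiantsHypothesis-21181): generic cofactors for ANY admissible block
# size are not certificates

`…NNDivisionHardStackPowersQueue.generic_not_certificate_qp` eliminates the cofactors generic in ONE pinned rainbow direction
(block size `a = ⌊(n+2)/3⌋`).  The generic-cofactor rung `complexity_nn_le_of_generic` holds for every block size `a` with
`4a+2 ≤ 2n`, `n ≤ 3a+1` — about `n/6` distinct directions `prWeight n a`, with pairwise different pin sets — and the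
quasi-polynomial bookkeeping only needs `n ≤ 3a+1`:

* `qp_of_exp_le_block` — for every `c`, eventually in `n`, for every `a` with `n ≤ 3a+1`: any `X` with
  `2^{a^{1/6}} ≤ X ≤ 5184(2n+1)⁶(L+1)⁴` forces `2^((log₂ n + c)^c) < L`;
* ★★ `genericBlock_not_certificate_qp` — for every `c`, eventually in `n`: for EVERY admissible block size `a` and EVERY
  cofactor `h` with a unique `prWeight n a`-maximal monomial, `2^((log₂ n + c)^c) < L₊(NN_n · h) + L₊(h)`.

So a cofactor in the open residual of stmt-21181 must TIE at the top of every one of these directions.  HONEST FRAMING: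
enlarges an eliminated class; the crux stays OPEN; nothing here bears on `NNNotVP` or on VP ≠ VNP (NOT proved).
References: Jukna–Seiwert–Sergeev 2022 Thm 1 [JuknaSeiwertSergeev2022]; Hrubeš–Yehudayoff 2021 §6 Problem 2 [HrubesYehudayoff2021].
-/

noncomputable section

-- Sub = Summit single-conjunct layout: the duplicated namespace component is mandated by the tree.
set_option linter.dupNamespace false
set_option autoImplicit false

namespace Summit.ValiantsHypothesis.ValiantsHypothesis.Theorems.FifoMatching.NNDivisionHard.GenericBlockFamily

open Finset MvPolynomial Literature.Computability.AlgebraicComplexity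
open Summit.ValiantsHypothesis.ValiantsHypothesis.Theorems.FifoMatching.NNDivisionHard.StackPowersQueue
  (prWeight exponent_le complexity_nn_le_of_generic)
open scoped NNReal BigOperators

/-- Quasi-polynomial bookkeeping for an arbitrary block size `a` with `n ≤ 3a+1`. [folklore] -/
theorem qp_of_exp_le_block (c : ℕ) : ∃ n₀ : ℕ, ∀ n : ℕ, n₀ ≤ n → ∀ a : ℕ, n ≤ 3 * a + 1 → ∀ L X : ℕ,
    (2 : ℝ) ^ ((a : ℝ) ^ ((1 : ℝ) / 6)) ≤ (X : ℝ) →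
      X ≤ 5184 * (2 * n + 1) ^ 6 * (L + 1) ^ 4 → 2 ^ ((Nat.log 2 n + c) ^ c) < L := by
  obtain ⟨n₂, hn₂⟩ := CorSandwich.polylog_lt_rpow_eventually (c + 36) (c := 1 / 6) (by norm_num)
  refine ⟨3 * n₂ + 7, fun n hn a ha L X HR HA => ?_⟩
  have ha0 : a ≠ 0 := by omega
  set q := (Nat.log 2 n + c) ^ c with hq
  by_contra hcon
  push Not at hcon
  have hlogn : 2 * n + 1 ≤ 2 ^ (Nat.log 2 n + 2) := by
    have := Nat.lt_pow_succ_log_self Nat.one_lt_two n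
    rw [pow_succ] at this ⊢
    omega
  have hq1 : 1 ≤ 2 ^ q := Nat.one_le_two_pow
  have hL1 : L + 1 ≤ 2 ^ (q + 1) := by rw [pow_succ]; omega
  have HB : X ≤ 2 ^ (4 * q + 6 * Nat.log 2 n + 29) :=
    calc X ≤ 5184 * (2 * n + 1) ^ 6 * (L + 1) ^ 4 := HA
      _ ≤ 2 ^ 13 * (2 ^ (Nat.log 2 n + 2)) ^ 6 * (2 ^ (q + 1)) ^ 4 := by gcongr; norm_num
      _ = 2 ^ (4 * q + 6 * Nat.log 2 n + 29) := by ring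
  have hlog : Nat.log 2 n ≤ Nat.log 2 a + 2 := by
    calc Nat.log 2 n ≤ Nat.log 2 (a * 2 * 2) := Nat.log_mono_right (by omega)
      _ = Nat.log 2 a + 2 := by
          rw [Nat.log_mul_base Nat.one_lt_two (by positivity), Nat.log_mul_base Nat.one_lt_two ha0]
  have HE : 4 * q + 6 * Nat.log 2 n + 29 ≤ (Nat.log 2 a + (c + 36)) ^ (c + 36) := exponent_le c _ _ hlog
  have HC : X ≤ 2 ^ ((Nat.log 2 a + (c + 36)) ^ (c + 36)) := HB.trans (Nat.pow_le_pow_right Nat.two_pos HE)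
  have HP := hn₂ a (by omega)
  have H : (2 : ℝ) ^ ((a : ℝ) ^ ((1 : ℝ) / 6)) ≤ (2 : ℝ) ^ ((((Nat.log 2 a + (c + 36)) ^ (c + 36) : ℕ) : ℝ)) := by
    calc (2 : ℝ) ^ ((a : ℝ) ^ ((1 : ℝ) / 6)) ≤ (X : ℝ) := HR
      _ ≤ ((2 ^ ((Nat.log 2 a + (c + 36)) ^ (c + 36)) : ℕ) : ℝ) := by exact_mod_cast HC
      _ = (2 : ℝ) ^ ((((Nat.log 2 a + (c + 36)) ^ (c + 36) : ℕ) : ℝ)) := by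
          rw [Nat.cast_pow, Nat.cast_ofNat, Real.rpow_natCast]
  have H' := (Real.rpow_le_rpow_left_iff one_lt_two).1 H
  linarith

/-- ★★ **GENERIC COFACTORS FOR ANY ADMISSIBLE BLOCK SIZE ARE NOT CERTIFICATES**: for every `c`, eventually in `n`, for
EVERY `a` with `4a+2 ≤ 2n`, `n ≤ 3a+1` and EVERY cofactor `h` with a unique `prWeight n a`-maximal monomial,
`2^((log₂ n + c)^c) < L₊(NN_n · h) + L₊(h)`. [cite: JuknaSeiwertSergeev2022, Thm 1] [cite: HrubesYehudayoff2021, §6 Problem 2] -/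
theorem genericBlock_not_certificate_qp (c : ℕ) : ∃ n₀ : ℕ, ∀ n : ℕ, n₀ ≤ n →
    ∀ a : ℕ, 4 * a + 2 ≤ 2 * n → n ≤ 3 * a + 1 →
    ∀ h : MvPolynomial (Fin (2 * n) × Fin (2 * n)) ℝ≥0, ∀ e ∈ h.support,
      (∀ e' ∈ h.support, e' ≠ e → Finsupp.weight (prWeight n a) e' < Finsupp.weight (prWeight n a) e) →
      2 ^ ((Nat.log 2 n + c) ^ c) < complexity (nestFreeMatchingPoly n ℝ≥0 * h) + complexity h := by
  obtain ⟨n₁, hn₁⟩ := NNMonotoneExpBound.exp_lower_bound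
  obtain ⟨n₀, hn₀⟩ := qp_of_exp_le_block c
  refine ⟨max n₀ (3 * n₁ + 1), fun n hn a h1 h2 h e he hgen => ?_⟩
  have HX := complexity_nn_le_of_generic h1 h2 h he hgen
  have HR := hn₁ a (by omega)
  exact lt_of_lt_of_le (hn₀ n (le_of_max_le_left hn) a h2 _ _ HR HX) (Nat.le_add_right _ _)

end Summit.ValiantsHypothesis.ValiantsHypothesis.Theorems.FifoMatching.NNDivisionHard.GenericBlockFamily

end
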